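import Summits.CriticalPhenomena.PercolationContinuityZ3.Theorems.SahiLiebSahiContinuumDensityPrelim

/-!
# The continuous case controls every absolutely continuous FKG measure on `Q_d`
# (log-supermodular bounded densities), and conversely

Companion of `SahiLiebSahiContinuum.lean` / `SahiTwoDimDensity.lean` (cell `prim-sahi`, typer, generation 6;
`--supports stmt-CriticalPhenomena-4575`).

Lieb–Sahi [LiebSahi2021, §1]: "if `Q_k = [0,1]^k` … then the FKG inequality holds for the Lebsegue measure, and more
generally for any absolutely continuous measure whose density function satisfies (sup-mod)".  The same is true of
the whole hierarchy `E_n ≥ 0`, order by order and dimension by dimension: `LiebSahiContinuum d n` (Lebesgue measure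
on `Q_d`) implies — indeed is EQUIVALENT to — `E_n ≥ 0` under every probability measure `ρ·λ` on `Q_d` with a
bounded measurable log-supermodular (MTP₂) density `ρ` (`liebSahiContinuum_iff_withDensity`).  The `d`-dimensional
version of generation 5's `SahiTwoDimDensity.mSahiPositive_withDensity` (which is the unconditional case `d = 2`):

* `lintegral_four_functions_unitCube` — Karlin–Rinott's continuous four functions theorem on `Q_d` (from the tree's
  `lintegral_four_functions` on `ℝ^ι`, along the inclusion / the coordinatewise clamp);
* `cubeCellWeight μ m` (masses of the `(m+1)^d` grid cells), `isFKGMeasure_cubeCellWeight_withDensity` — the cell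
  weights of an MTP₂ density form an FKG weight on the box `[m+1]^d` (the cell map is a lattice homomorphism);
* the weighted Riemann sandwich on `Q_d` (`ex_hiCube_sub_ex_loCube_le`, gap `≤ R·d·(g(1)−g(0))/(m+1)` for cell
  weights `≤ R`·Lebesgue, by `LebesgueCube.sum_gap_mul_le`), `tendsto_gridMoment`, `msahiE_nonneg_of_cubeCellWeights`;
* **`msahiE_withDensity_nonneg_of_liebSahiContinuum`**, `…_antitone`: `LiebSahiContinuum d n ⇒ E_n ≥ 0` under
  `ρ·λ` for all nonnegative monotone (increasing / decreasing) families, through the layer `W(d,n)`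
  (`liebSahiContinuum_iff_fkgGrid`) applied to the FKG cell weights;
* **`liebSahiContinuum_iff_withDensity`**; unconditionally `msahiE_withDensity_nonneg_of_le_two` (`d ≤ 2`).

No measurability of the families is needed (monotone functions on `Q_d` are a.e. Borel, `ρ·λ ≪ λ`).
-/

noncomputable section

namespace Summit.CriticalPhenomena.PercolationContinuityZ3.Theorems.SahiCubeDensity

open MeasureTheory Set Filter Topology Finset Literature.Combinatorics.Sahi2008
  Literature.Combinatorics.Sahi2008.LebesgueCube
open scoped unitInterval ENNReal NNReal

variable {d n : ℕ}

/-! ## The continuous case ⟹ every absolutely continuous FKG measure on `Q_d` -/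

/-- **`LiebSahiContinuum d n` ⟹ every absolutely continuous FKG measure on `Q_d`, increasing families**: for a
measurable, bounded, log-supermodular density `ρ` on `Q_d` with `∫ρ dλ = 1`, all nonnegative monotone increasing
families have `E_n(f_0,…,f_{n−1}) ≥ 0` under `ρ·λ` — through the layer `W(d,n)` (FKG weights on the boxes
`[m+1]^d`, `liebSahiContinuum_iff_fkgGrid`) applied to the FKG cell weights of `ρ`. [this work] -/
theorem mSahiPositive_withDensity_of_liebSahiContinuum (h : LiebSahiContinuum d n) (ρ : (Fin d → I) → ℝ≥0∞)
    (hρm : Measurable ρ) {R : ℝ≥0} (hρR : ∀ x, ρ x ≤ R) (hρ : ∀ x y, ρ x * ρ y ≤ ρ (x ⊔ y) * ρ (x ⊓ y))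
    [IsProbabilityMeasure (volume.withDensity ρ)] : MSahiPositive (volume.withDensity ρ) n := by
  intro f hf0 hmono
  have hW := (liebSahiContinuum_iff_fkgGrid d n).1 h
  exact msahiE_nonneg_of_cubeCellWeights _ (withDensity_absolutelyContinuous _ _) (cubeCellWeight_withDensity_le ρ hρR)
    (fun m => hW m _ (isFKGMeasure_cubeCellWeight_withDensity ρ hρm hρ m)) f hf0 hmono

/-- The central reflection of `Q_d` (plumbing). [this work] -/
private def refl (x : Fin d → I) : Fin d → I := fun j => unitInterval.symm (x j)

/-- The reflection is a measurable embedding (plumbing). [this work] -/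
private theorem measurableEmbedding_refl : MeasurableEmbedding (refl (d := d)) :=
  (MeasurableEquiv.piCongrRight fun _ : Fin d => unitInterval.symmMeasurableEquiv).measurableEmbedding

/-- The reflection preserves Lebesgue measure (plumbing). [this work] -/
private theorem measurePreserving_refl : MeasurePreserving (refl (d := d)) volume volume :=
  volume_preserving_pi fun _ => unitInterval.measurePreserving_symm

/-- The reflection reverses `⊔` and `⊓` (plumbing). [this work] -/
private theorem refl_sup (x y : Fin d → I) : refl (x ⊔ y) = refl x ⊓ refl y := by
  funext j
  simp only [refl, Pi.sup_apply, Pi.inf_apply]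
  rcases le_total (x j) (y j) with hxy | hxy
  · rw [sup_eq_right.2 hxy, inf_eq_right.2 (unitInterval.symm_le_symm.2 hxy)]
  · rw [sup_eq_left.2 hxy, inf_eq_left.2 (unitInterval.symm_le_symm.2 hxy)]

/-- The reflection reverses `⊓` and `⊔` (plumbing). [this work] -/
private theorem refl_inf (x y : Fin d → I) : refl (x ⊓ y) = refl x ⊔ refl y := by
  funext j
  simp only [refl, Pi.sup_apply, Pi.inf_apply]
  rcases le_total (x j) (y j) with hxy | hxy
  · rw [inf_eq_left.2 hxy, sup_eq_left.2 (unitInterval.symm_le_symm.2 hxy)]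
  · rw [inf_eq_right.2 hxy, sup_eq_right.2 (unitInterval.symm_le_symm.2 hxy)]

/-- The reflection pushes `(ρ ∘ refl)·λ` to `ρ·λ` (plumbing). [this work] -/
private theorem measurePreserving_refl_withDensity (ρ : (Fin d → I) → ℝ≥0∞) (hρm : Measurable ρ) :
    MeasurePreserving (refl (d := d)) (volume.withDensity (ρ ∘ refl)) (volume.withDensity ρ) := by
  refine ⟨measurableEmbedding_refl.measurable, ?_⟩
  ext s hs
  rw [Measure.map_apply measurableEmbedding_refl.measurable hs,
    withDensity_apply _ (measurableEmbedding_refl.measurable hs), withDensity_apply _ hs]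
  exact measurePreserving_refl.setLIntegral_comp_preimage hs hρm

/-- **`LiebSahiContinuum d n` ⟹ every absolutely continuous FKG measure on `Q_d`, decreasing families** (the
printed form; apply the increasing form to the reflected density `ρ ∘ refl`). [this work] -/
theorem msahiE_withDensity_nonneg_of_liebSahiContinuum_antitone (h : LiebSahiContinuum d n)
    (ρ : (Fin d → I) → ℝ≥0∞) (hρm : Measurable ρ) {R : ℝ≥0} (hρR : ∀ x, ρ x ≤ R)
    (hρ : ∀ x y, ρ x * ρ y ≤ ρ (x ⊔ y) * ρ (x ⊓ y)) [IsProbabilityMeasure (volume.withDensity ρ)]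
    (f : Fin n → (Fin d → I) → ℝ) (hf0 : ∀ i x, 0 ≤ f i x) (hanti : ∀ i, Antitone (f i)) :
    0 ≤ msahiE (volume.withDensity ρ) n f := by
  have hpush := measurePreserving_refl_withDensity ρ hρm
  haveI : IsProbabilityMeasure (volume.withDensity (ρ ∘ refl (d := d))) := by
    constructor
    have h1 := hpush.measure_preimage (s := Set.univ) MeasurableSet.univ.nullMeasurableSet
    rw [Set.preimage_univ] at h1
    rw [h1]
    exact measure_univ
  rw [← msahiE_comp_measurePreserving hpush measurableEmbedding_refl n f]
  refine mSahiPositive_withDensity_of_liebSahiContinuum h (ρ ∘ refl) (hρm.comp measurableEmbedding_refl.measurable)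
    (fun x => hρR _) (fun x y => ?_) _ (fun i x => hf0 i _) fun i x y hxy => hanti i fun j => ?_
  · simp only [Function.comp_apply, refl_sup, refl_inf]
    rw [mul_comm (ρ (refl x ⊓ refl y))]
    exact hρ (refl x) (refl y)
  · exact unitInterval.symm_le_symm.2 (hxy j)

/-- **The continuous case is a statement about all absolutely continuous FKG measures**: `LiebSahiContinuum d n`
holds iff every probability measure `ρ·λ` on `Q_d` with a measurable, bounded, log-supermodular density satisfies
`E_n ≥ 0` for all nonnegative monotone increasing families (`⇐`: `ρ ≡ 1`). [this work] -/
theorem liebSahiContinuum_iff_withDensity :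
    LiebSahiContinuum d n ↔
      ∀ (ρ : (Fin d → I) → ℝ≥0∞), Measurable ρ → (∃ R : ℝ≥0, ∀ x, ρ x ≤ R) →
        (∀ x y, ρ x * ρ y ≤ ρ (x ⊔ y) * ρ (x ⊓ y)) → IsProbabilityMeasure (volume.withDensity ρ) →
          MSahiPositive (volume.withDensity ρ) n := by
  constructor
  · rintro h ρ hρm ⟨R, hρR⟩ hρ hprob
    exact mSahiPositive_withDensity_of_liebSahiContinuum h ρ hρm hρR hρ
  · intro h
    have h1 := h 1 measurable_const ⟨1, fun _ => le_rfl⟩ (fun _ _ => le_rfl) (by rw [withDensity_one]; infer_instance)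
    rw [withDensity_one] at h1
    exact liebSahiContinuum_iff_mSahiPositive.2 h1

/-- **Unconditionally, `d ≤ 2`: every absolutely continuous FKG probability measure on `Q_d` with bounded density is
Sahi-positive of every order** (the `Fin d → I` form of `SahiTwoDimDensity.mSahiPositive_withDensity`). [this work] -/
theorem mSahiPositive_withDensity_of_le_two (hd : d ≤ 2) (ρ : (Fin d → I) → ℝ≥0∞) (hρm : Measurable ρ)
    {R : ℝ≥0} (hρR : ∀ x, ρ x ≤ R) (hρ : ∀ x y, ρ x * ρ y ≤ ρ (x ⊔ y) * ρ (x ⊓ y))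
    [IsProbabilityMeasure (volume.withDensity ρ)] (n : ℕ) : MSahiPositive (volume.withDensity ρ) n :=
  mSahiPositive_withDensity_of_liebSahiContinuum (liebSahiContinuum_of_le_two hd n) ρ hρm hρR hρ

end Summit.CriticalPhenomena.PercolationContinuityZ3.Theorems.SahiCubeDensity
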